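import Summits.Ventures.DiscreteObjects.Hadamard.SignedMultiplierTMatrices668

/-!
# Hadamard 668 census — signed and permuted multipliers of circulant T-matrices of order 167, II: the census for `-1`

Framing: lottery ticket; floor = certified bounds/negative ranges.

Cell pub-namedobj (venture DiscreteObjects), target (H), hadamard gen 25 (HANDOFF-H-g24 item 5b), continuing
`SignedMultiplierTMatrices668` (there: a signed/permuted multiplier `t_{π k}(h x) = ε_k t_k(x)` of first rows of circulant
T-matrices of order `167` has `h = -1`).  Here `h = -1`, i.e. `t_{π k}(-x) = ε_k t_k(x)`: the row `k₀` through `0` is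
fixed with `ε_{k₀} = +1` and ODD row sum, every other `π`-fixed row has EVEN row sum, `|Σ t_{π k}| = |Σ t_k|`, and the
periodic grammar reads `Σ_k (Σ_x t_k(x))² = 167 ≡ 7 (mod 8)`.  Consequences (kernel):
* `perm_fin4_fixing_trichotomy` — a permutation of four letters fixing one is the identity, a `3`-cycle or a transposition on
  the other three (`decide +kernel` over `S₄`);
* **`no_signedSymmetric_tMatrixRows_167`** — `π = id` with ANY signs is impossible (`167 ≠ odd² + Σ even² (mod 4)`;
  gen 24's `no_symmetric_tMatrixRows_167` is the all-`+` case);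
* **`no_threeCycle_signedMultiplier_167`** — a `3`-cycle is impossible (`167 = b² + 3a²`, `b` odd, needs `3a² ≡ 6 (mod 8)`);
* **`signedMultiplier_negOne_167_census`**, `signedMultiplier_negOne_167_isSwap` — hence `π` is a TRANSPOSITION of two rows
  vanishing at `0` (so `π` never moves `k₀`: double transpositions and `4`-cycles are impossible too), and the row sums
  `a, a'` (swapped pair), `b` (row `k₀`), `c` (fourth row) satisfy `|a'| = |a|`, `167 = 2a² + b² + c²`,
  `(|a|, |b|, |c|) ∈ {(3, 7, 10), (5, 9, 6), (9, 1, 2)}` (typed survivor table, `decide +kernel` over a `10 × 13 × 13` box);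
* `signedMultiplier_negOne_167_signs` — in the residual shape the row through `0` and the fourth row are symmetric and the
  swapped pair carries equal signs.
Part III (`SignedMultiplierTMatrices668Final`) removes the residual transposition shape by a parity (group ring mod 2)
argument, so that NO signed/permuted multiplier survives at `167`.  STRUCTURE/NEGATIVE lines about a hypothetical object;
no Hadamard order excluded; H(668) untouched; HITS 0/4.  Ours, elementary; no `sorry`.
-/

open Finset BigOperators

namespace Summit.Ventures.DiscreteObjects.Hadamard

open Literature.Combinatorics.Designs.LegendrePairs (PAF)
open Literature.Combinatorics.Designs.TSequences
open Literature.Combinatorics.Designs.TMatrices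

/-! ## §5 Shapes of a permutation of four letters fixing a letter; bookkeeping -/

/-- a permutation of `Fin 4` fixing `k₀` is the identity, a `3`-cycle on the other three letters, or a transposition of
two of them fixing the third (kernel enumeration of `S₄`). -/
lemma perm_fin4_fixing_trichotomy :
    ∀ (π : Equiv.Perm (Fin 4)) (k₀ : Fin 4), π k₀ = k₀ →
      (∀ k, π k = k) ∨
      (∃ k₁ k₂ k₃ : Fin 4, k₁ ≠ k₀ ∧ k₂ ≠ k₀ ∧ k₃ ≠ k₀ ∧ k₁ ≠ k₂ ∧ k₁ ≠ k₃ ∧ k₂ ≠ k₃ ∧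
        π k₁ = k₂ ∧ π k₂ = k₃ ∧ π k₃ = k₁) ∨
      (∃ k₁ k₂ k₃ : Fin 4, k₁ ≠ k₀ ∧ k₂ ≠ k₀ ∧ k₃ ≠ k₀ ∧ k₁ ≠ k₂ ∧ k₁ ≠ k₃ ∧ k₂ ≠ k₃ ∧
        π k₁ = k₂ ∧ π k₂ = k₁ ∧ π k₃ = k₃) := by
  decide +kernel

/-- a sum over `Fin 4` listed along four distinct letters. -/
lemma sum_fin4_of_distinct (f : Fin 4 → ℤ) {k₀ k₁ k₂ k₃ : Fin 4} (h01 : k₀ ≠ k₁) (h02 : k₀ ≠ k₂) (h03 : k₀ ≠ k₃)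
    (h12 : k₁ ≠ k₂) (h13 : k₁ ≠ k₃) (h23 : k₂ ≠ k₃) : ∑ k, f k = f k₀ + f k₁ + f k₂ + f k₃ := by
  have huniv : (univ : Finset (Fin 4)) = {k₀, k₁, k₂, k₃} := by
    symm
    apply Finset.eq_univ_of_card
    rw [Finset.card_insert_of_notMem (by simp [h01, h02, h03]), Finset.card_insert_of_notMem (by simp [h12, h13]),
      Finset.card_insert_of_notMem (by simp [h23]), Finset.card_singleton, Fintype.card_fin]
  rw [huniv, Finset.sum_insert (by simp [h01, h02, h03]), Finset.sum_insert (by simp [h12, h13]),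
    Finset.sum_insert (by simp [h23]), Finset.sum_singleton]
  ring

/-- squares are `0, 1` or `4` modulo `8`; bookkeeping form: `z² = 8K + r`. -/
lemma sq_mod_eight (z : ℤ) : ∃ K : ℤ, z ^ 2 = 8 * K ∨ z ^ 2 = 8 * K + 1 ∨ z ^ 2 = 8 * K + 4 := by
  obtain ⟨q, r, hr, hz⟩ : ∃ q r : ℤ, (0 ≤ r ∧ r < 4) ∧ z = 4 * q + r :=
    ⟨z / 4, z % 4, ⟨Int.emod_nonneg _ (by norm_num), Int.emod_lt_of_pos _ (by norm_num)⟩, by omega⟩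
  have hr' : r = 0 ∨ r = 1 ∨ r = 2 ∨ r = 3 := by omega
  rcases hr' with rfl | rfl | rfl | rfl
  · exact ⟨2 * q ^ 2, Or.inl (by rw [hz]; ring)⟩
  · exact ⟨2 * q ^ 2 + q, Or.inr (Or.inl (by rw [hz]; ring))⟩
  · exact ⟨2 * q ^ 2 + 2 * q, Or.inr (Or.inr (by rw [hz]; ring))⟩
  · exact ⟨2 * q ^ 2 + 3 * q + 1, Or.inr (Or.inl (by rw [hz]; ring))⟩

/-- an odd square is `1 (mod 8)`. -/
lemma sq_of_odd_mod_eight {z : ℤ} (hz : Odd z) : ∃ K : ℤ, z ^ 2 = 8 * K + 1 := by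
  obtain ⟨m, rfl⟩ := hz
  obtain ⟨q, r, hr, hm⟩ : ∃ q r : ℤ, (0 ≤ r ∧ r < 2) ∧ m = 2 * q + r :=
    ⟨m / 2, m % 2, ⟨Int.emod_nonneg _ (by norm_num), Int.emod_lt_of_pos _ (by norm_num)⟩, by omega⟩
  have hr' : r = 0 ∨ r = 1 := by omega
  rcases hr' with rfl | rfl
  · exact ⟨2 * q ^ 2 + q, by rw [hm]; ring⟩
  · exact ⟨2 * q ^ 2 + 3 * q + 1, by rw [hm]; ring⟩

/-- an even square is `0 (mod 4)`; bookkeeping form. -/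
lemma sq_of_even {z : ℤ} (hz : Even z) : ∃ K : ℤ, z ^ 2 = 4 * K := by
  obtain ⟨m, rfl⟩ := hz
  exact ⟨m ^ 2, by ring⟩

/-- **the survivor table**: `2a² + b² + c² = 167` with `b` odd forces `(a, b, c) ∈ {(3,7,10), (5,9,6), (9,1,2)}` (naturals). -/
lemma table_2a2_b2_c2 (a b c : ℕ) (h : 2 * a ^ 2 + b ^ 2 + c ^ 2 = 167) (hb : b % 2 = 1) :
    (a = 3 ∧ b = 7 ∧ c = 10) ∨ (a = 5 ∧ b = 9 ∧ c = 6) ∨ (a = 9 ∧ b = 1 ∧ c = 2) := by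
  have ha : a < 10 := by nlinarith
  have hb' : b < 13 := by nlinarith
  have hc : c < 13 := by nlinarith
  have key : ∀ a ∈ Finset.range 10, ∀ b ∈ Finset.range 13, ∀ c ∈ Finset.range 13,
      2 * a ^ 2 + b ^ 2 + c ^ 2 = 167 → b % 2 = 1 →
        (a = 3 ∧ b = 7 ∧ c = 10) ∨ (a = 5 ∧ b = 9 ∧ c = 6) ∨ (a = 9 ∧ b = 1 ∧ c = 2) := by
    decide
  exact key a (Finset.mem_range.mpr ha) b (Finset.mem_range.mpr hb') c (Finset.mem_range.mpr hc) h hb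

/-! ## §6 The census for the multiplier `-1` -/

section Census

variable {t : Fin 4 → ZMod 167 → ℤ} {π : Equiv.Perm (Fin 4)} {ε : Fin 4 → ℤ}

/-- unpacking the hypotheses for `h = -1`: the distinguished row `k₀` (non-zero at `0`) is fixed by `π` with `ε_{k₀} = 1`
and has odd row sum; the other rows vanish at `0`. -/
lemma negMultiplier_basic (ht : IsTMatrixRows 167 t) (hε : ∀ k, ε k = 1 ∨ ε k = -1)
    (hmul : ∀ k x, t (π k) (-x) = ε k * t k x) :
    ∃ k₀, t k₀ 0 ≠ 0 ∧ (∀ k, k ≠ k₀ → t k 0 = 0) ∧ π k₀ = k₀ ∧ ε k₀ = 1 ∧ Odd (∑ x, t k₀ x) := by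
  obtain ⟨k₀, hk₀, h0⟩ := ht.1 0
  have hk₀ne : t k₀ 0 ≠ 0 := by rcases hk₀ with e | e <;> simp [e]
  obtain ⟨hπ₀, hε₀⟩ := fixed_of_negMultiplier ht hε hmul hk₀ne
  refine ⟨k₀, hk₀ne, h0, hπ₀, hε₀, ?_⟩
  have hsym : ∀ x, t k₀ (-x) = t k₀ x := fun x => by
    have e := hmul k₀ x
    rw [hπ₀, hε₀, one_mul] at e
    exact e
  have h2 := sum_symm_castTwo (n := 167) (by norm_num) (t k₀) hsym
  rw [ZMod.intCast_eq_intCast_iff_dvd_sub] at h2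
  rcases hk₀ with e | e <;> rw [e] at h2
  · rcases h2 with ⟨m, hm⟩
    exact ⟨-m, by push_cast at hm; linarith⟩
  · rcases h2 with ⟨m, hm⟩
    exact ⟨-m - 1, by push_cast at hm; linarith⟩

/-- **`π = id` is impossible (any signs)**: symmetric-or-skew rows, `t_k(-x) = ε_k t_k(x)` for all `k`, cannot be first
rows of circulant T-matrices of order `167` — the row through `0` has odd sum, the others even sums, and
`167 ≡ 3 (mod 4)` is not `odd² + Σ even²`.  (Gen 24's `no_symmetric_tMatrixRows_167` is the case `ε ≡ +1`.) -/
theorem no_signedSymmetric_tMatrixRows_167 :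
    ¬ ∃ (t : Fin 4 → ZMod 167 → ℤ) (ε : Fin 4 → ℤ),
      IsTMatrixRows 167 t ∧ (∀ k, ε k = 1 ∨ ε k = -1) ∧ ∀ k x, t k (-x) = ε k * t k x := by
  rintro ⟨t, ε, ht, hε, hmul⟩
  have hmul' : ∀ k x, t ((1 : Equiv.Perm (Fin 4)) k) (-x) = ε k * t k x := fun k x => by
    simpa using hmul k x
  obtain ⟨k₀, -, h0, -, -, hodd⟩ := negMultiplier_basic ht hε hmul'
  have heven : ∀ k, k ≠ k₀ → Even (∑ x, t k x) := fun k hk =>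
    even_rowSum_of_fixed (n := 167) (by norm_num) hε hmul' (by simp) (h0 k hk)
  have hgram := tmatrixRows_sum_sq ht
  rw [← Finset.add_sum_erase _ _ (mem_univ k₀)] at hgram
  obtain ⟨K₀, hK₀⟩ := sq_of_odd_mod_eight hodd
  have h4 : (4 : ℤ) ∣ ∑ k ∈ univ.erase k₀, (∑ x, t k x) ^ 2 :=
    Finset.dvd_sum fun k hk => by
      obtain ⟨K, hK⟩ := sq_of_even (heven k (Finset.ne_of_mem_erase hk))
      exact ⟨K, hK⟩
  obtain ⟨M, hM⟩ := h4
  rw [hM, hK₀] at hgram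
  push_cast at hgram
  omega

/-- **a `3`-cycle on the three rows vanishing at `0` is impossible**: the three row sums would have a common absolute
value `a` and `167 = b² + 3a²` with `b` odd, i.e. `3a² ≡ 6 (mod 8)` — but `3a² (mod 8) ∈ {0, 3, 4}`. -/
theorem no_threeCycle_signedMultiplier_167 (ht : IsTMatrixRows 167 t) (hε : ∀ k, ε k = 1 ∨ ε k = -1)
    (hmul : ∀ k x, t (π k) (-x) = ε k * t k x) {k₁ k₂ k₃ : Fin 4} (h12 : k₁ ≠ k₂) (h13 : k₁ ≠ k₃) (h23 : k₂ ≠ k₃)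
    (hc1 : π k₁ = k₂) (hc2 : π k₂ = k₃) (hc3 : π k₃ = k₁) : False := by
  obtain ⟨k₀, -, -, hπ₀, -, hodd⟩ := negMultiplier_basic ht hε hmul
  have h01 : k₀ ≠ k₁ := fun e => h12 (by rw [← e, ← hc1, ← e, hπ₀])
  have h02 : k₀ ≠ k₂ := fun e => h23 (by rw [← e, ← hc2, ← e, hπ₀])
  have h03 : k₀ ≠ k₃ := fun e => h13 (by rw [← hc3, ← e, hπ₀])
  have hgram := tmatrixRows_sum_sq ht
  rw [sum_fin4_of_distinct _ h01 h02 h03 h12 h13 h23] at hgram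
  have e12 : (∑ x, t k₂ x) ^ 2 = (∑ x, t k₁ x) ^ 2 := by
    rw [← hc1]; exact rowSum_sq_perm_of_negMultiplier hε hmul k₁
  have e23 : (∑ x, t k₃ x) ^ 2 = (∑ x, t k₂ x) ^ 2 := by
    rw [← hc2]; exact rowSum_sq_perm_of_negMultiplier hε hmul k₂
  obtain ⟨K₀, hK₀⟩ := sq_of_odd_mod_eight hodd
  obtain ⟨K₁, hK₁⟩ := sq_mod_eight (∑ x, t k₁ x)
  rw [e23, e12, hK₀] at hgram
  push_cast at hgram
  rcases hK₁ with e | e | e <;> rw [e] at hgram <;> omega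

/-- **THE CENSUS for the multiplier `-1` with a row permutation and signs.**  If first rows `t` of circulant T-matrices
of order `167` satisfy `t_{π k}(-x) = ε_k t_k(x)`, then `π` is a TRANSPOSITION `(k₁ k₂)` of two rows vanishing at `0`,
fixing the row `k₀` through `0` (`ε_{k₀} = 1`) and a fourth row `k₃`; the row sums `a = Σ t_{k₁}`, `a' = Σ t_{k₂}`,
`b = Σ t_{k₀}`, `c = Σ t_{k₃}` satisfy `|a'| = |a|` and `(|a|, |b|, |c|) ∈ {(3, 7, 10), (5, 9, 6), (9, 1, 2)}`
(`167 = 2a² + b² + c²`, `b` odd, `c` even). -/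
theorem signedMultiplier_negOne_167_census (ht : IsTMatrixRows 167 t) (hε : ∀ k, ε k = 1 ∨ ε k = -1)
    (hmul : ∀ k x, t (π k) (-x) = ε k * t k x) :
    ∃ k₀ k₁ k₂ k₃ : Fin 4, k₁ ≠ k₀ ∧ k₂ ≠ k₀ ∧ k₃ ≠ k₀ ∧ k₁ ≠ k₂ ∧ k₁ ≠ k₃ ∧ k₂ ≠ k₃ ∧
      t k₀ 0 ≠ 0 ∧ π k₀ = k₀ ∧ ε k₀ = 1 ∧ π k₁ = k₂ ∧ π k₂ = k₁ ∧ π k₃ = k₃ ∧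
      (∑ x, t k₂ x).natAbs = (∑ x, t k₁ x).natAbs ∧
      (((∑ x, t k₁ x).natAbs = 3 ∧ (∑ x, t k₀ x).natAbs = 7 ∧ (∑ x, t k₃ x).natAbs = 10) ∨
       ((∑ x, t k₁ x).natAbs = 5 ∧ (∑ x, t k₀ x).natAbs = 9 ∧ (∑ x, t k₃ x).natAbs = 6) ∨
       ((∑ x, t k₁ x).natAbs = 9 ∧ (∑ x, t k₀ x).natAbs = 1 ∧ (∑ x, t k₃ x).natAbs = 2)) := by
  obtain ⟨k₀, hk₀, h0, hπ₀, hε₀, hodd⟩ := negMultiplier_basic ht hε hmul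
  rcases perm_fin4_fixing_trichotomy π k₀ hπ₀ with hall | ⟨k₁, k₂, k₃, -, -, -, h12, h13, h23, c1, c2, c3⟩ |
      ⟨k₁, k₂, k₃, h10, h20, h30, h12, h13, h23, c1, c2, c3⟩
  · -- identity: excluded
    exfalso
    refine no_signedSymmetric_tMatrixRows_167 ⟨t, ε, ht, hε, fun k x => ?_⟩
    rw [← hmul k x, hall k]
  · -- 3-cycle: excluded
    exact (no_threeCycle_signedMultiplier_167 ht hε hmul h12 h13 h23 c1 c2 c3).elim
  · -- transposition: the table
    have e12 : (∑ x, t k₂ x) ^ 2 = (∑ x, t k₁ x) ^ 2 := by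
      rw [← c1]; exact rowSum_sq_perm_of_negMultiplier hε hmul k₁
    refine ⟨k₀, k₁, k₂, k₃, h10, h20, h30, h12, h13, h23, hk₀, hπ₀, hε₀, c1, c2, c3,
      Int.natAbs_eq_iff_sq_eq.mpr e12, ?_⟩
    have hgram := tmatrixRows_sum_sq ht
    rw [sum_fin4_of_distinct _ (Ne.symm h10) (Ne.symm h20) (Ne.symm h30) h12 h13 h23, e12] at hgram
    push_cast at hgram
    have hN : 2 * (∑ x, t k₁ x).natAbs ^ 2 + (∑ x, t k₀ x).natAbs ^ 2 + (∑ x, t k₃ x).natAbs ^ 2 = 167 := by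
      have h' : 2 * ((∑ x, t k₁ x).natAbs : ℤ) ^ 2 + ((∑ x, t k₀ x).natAbs : ℤ) ^ 2 +
          ((∑ x, t k₃ x).natAbs : ℤ) ^ 2 = 167 := by
        rw [Int.natAbs_pow_two, Int.natAbs_pow_two, Int.natAbs_pow_two]
        linarith
      exact_mod_cast h'
    have hb : (∑ x, t k₀ x).natAbs % 2 = 1 := Nat.odd_iff.mp (Int.natAbs_odd.mpr hodd)
    exact table_2a2_b2_c2 _ _ _ hN hb

/-- **signs and symmetries in the residual family**: the row through `0` and the fourth row are SYMMETRIC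
(`ε_{k₀} = ε_{k₃} = +1`; the fourth row sum is `±10, ±6, ±2 ≠ 0`, so it is not skew), the swapped rows carry equal signs
`ε_{k₁} = ε_{k₂}` (their sums are `±3, ±5, ±9 ≠ 0`), and row `k₂` is the signed reversal of row `k₁`. -/
theorem signedMultiplier_negOne_167_signs (ht : IsTMatrixRows 167 t) (hε : ∀ k, ε k = 1 ∨ ε k = -1)
    (hmul : ∀ k x, t (π k) (-x) = ε k * t k x) :
    ∃ k₀ k₁ k₂ k₃ : Fin 4, k₁ ≠ k₀ ∧ k₂ ≠ k₀ ∧ k₃ ≠ k₀ ∧ k₁ ≠ k₂ ∧ k₁ ≠ k₃ ∧ k₂ ≠ k₃ ∧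
      π k₀ = k₀ ∧ π k₁ = k₂ ∧ π k₂ = k₁ ∧ π k₃ = k₃ ∧ ε k₀ = 1 ∧ ε k₃ = 1 ∧ ε k₁ = ε k₂ ∧
      (∀ x, t k₀ (-x) = t k₀ x) ∧ (∀ x, t k₃ (-x) = t k₃ x) ∧ (∀ x, t k₂ (-x) = ε k₁ * t k₁ x) := by
  obtain ⟨k₀, k₁, k₂, k₃, h10, h20, h30, h12, h13, h23, -, hπ₀, hε₀, c1, c2, c3, -, htab⟩ :=
    signedMultiplier_negOne_167_census ht hε hmul
  have hS3 : (∑ x, t k₃ x) ≠ 0 := fun h0 => by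
    rw [h0, Int.natAbs_zero] at htab; omega
  have hS1 : (∑ x, t k₁ x) ≠ 0 := fun h0 => by
    rw [h0, Int.natAbs_zero] at htab; omega
  have hε₃ : ε k₃ = 1 := by
    have e := rowSum_perm_of_negMultiplier hmul k₃
    rw [c3] at e
    rcases hε k₃ with h | h
    · exact h
    · exfalso; rw [h] at e; apply hS3; linarith
  have hε12 : ε k₁ = ε k₂ := by
    have e1 := rowSum_perm_of_negMultiplier hmul k₁
    have e2 := rowSum_perm_of_negMultiplier hmul k₂
    rw [c1] at e1
    rw [c2] at e2
    rcases hε k₁ with a | a <;> rcases hε k₂ with b | b <;> rw [a, b] <;> rw [a] at e1 <;> rw [b] at e2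
    · exfalso; apply hS1; linarith
    · exfalso; apply hS1; linarith
  refine ⟨k₀, k₁, k₂, k₃, h10, h20, h30, h12, h13, h23, hπ₀, c1, c2, c3, hε₀, hε₃, hε12, fun x => ?_, fun x => ?_,
    fun x => ?_⟩
  · have e := hmul k₀ x
    rw [hπ₀, hε₀, one_mul] at e
    exact e
  · have e := hmul k₃ x
    rw [c3, hε₃, one_mul] at e
    exact e
  · have e := hmul k₁ x
    rw [c1] at e
    exact e

/-- existence form of the census: apart from the transposition shape, **no signed/permuted multiplier `-1`** — in
particular `π` moving the row through `0`, double transpositions, `3`-cycles and `4`-cycles are all impossible. -/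
theorem signedMultiplier_negOne_167_isSwap (ht : IsTMatrixRows 167 t) (hε : ∀ k, ε k = 1 ∨ ε k = -1)
    (hmul : ∀ k x, t (π k) (-x) = ε k * t k x) :
    ∃ k₁ k₂ : Fin 4, k₁ ≠ k₂ ∧ π = Equiv.swap k₁ k₂ ∧ t k₁ 0 = 0 ∧ t k₂ 0 = 0 := by
  obtain ⟨k₀, k₁, k₂, k₃, h10, h20, h30, h12, h13, h23, hk₀, hπ₀, -, c1, c2, c3, -⟩ :=
    signedMultiplier_negOne_167_census ht hε hmul
  obtain ⟨k', -, huniq⟩ := ht.1 0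
  have hk' : k₀ = k' := by
    by_contra hne
    exact hk₀ (huniq k₀ hne)
  have h0 : ∀ k, k ≠ k₀ → t k 0 = 0 := fun k hk => huniq k (by rw [← hk']; exact hk)
  refine ⟨k₁, k₂, h12, ?_, h0 k₁ h10, h0 k₂ h20⟩
  ext k
  -- `k` is one of the four letters
  have hfour : k = k₀ ∨ k = k₁ ∨ k = k₂ ∨ k = k₃ := by
    have hmem : k ∈ ({k₀, k₁, k₂, k₃} : Finset (Fin 4)) := by
      have huniv : ({k₀, k₁, k₂, k₃} : Finset (Fin 4)) = univ := by
        apply Finset.eq_univ_of_card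
        rw [Finset.card_insert_of_notMem (by simp [Ne.symm h10, Ne.symm h20, Ne.symm h30]),
          Finset.card_insert_of_notMem (by simp [h12, h13]), Finset.card_insert_of_notMem (by simp [h23]),
          Finset.card_singleton, Fintype.card_fin]
      rw [huniv]; exact mem_univ k
    simpa using hmem
  rcases hfour with rfl | rfl | rfl | rfl
  · rw [hπ₀, Equiv.swap_apply_of_ne_of_ne (Ne.symm h10) (Ne.symm h20)]
  · rw [c1, Equiv.swap_apply_left]
  · rw [c2, Equiv.swap_apply_right]
  · rw [c3, Equiv.swap_apply_of_ne_of_ne (Ne.symm h13) (Ne.symm h23)]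

end Census

end Summit.Ventures.DiscreteObjects.Hadamard
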